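import Mathlib
import Summits.ValiantsHypothesis.ValiantsHypothesis.Theorems.LacunarySymmetroidMatrixDescartesStubInertiaChain

/-!
# Crux `DerivedPencilRolleQuasi` (stmt-ValiantsHypothesis-18064), PSD sector with MULTIPLICITY —
# part 1: the multiplicity of a root of `det M(X)` is the nullity of `M(τ)` when `M′(τ)` is
# positive definite on the kernel

For a polynomial matrix `M : Matrix ι ι ℝ[X]` and a real point `τ` write `A = M(τ)` and
`D = M′(τ)` (entrywise evaluation of the formal derivative).  A **kernel frame** of `A` is a basis
`b` of `ι → ℝ` (indexed by `ι` itself) together with a finset `S` of indices such that the `b j`,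
`j ∈ S`, lie in `ker A` and no nontrivial combination of the other basis vectors does
(`exists_kernelFrame`: take bases of `ker A` and of a complement).  The main result
`rootMultiplicity_det_eq_card`: if `A` is symmetric and the quadratic form of `D` is positive on the
nonzero vectors of `span {b j : j ∈ S} = ker A`, then `rootMultiplicity τ (det M) = card S`.

Proof: conjugate by the (constant) change-of-basis matrix `U` whose columns are the `b j`:
`G = Uᵀ M U` has entries `G i j (s) = b i ⬝ᵥ M(s) b j`; the rows `i ∈ S` vanish at `τ`
(symmetry of `A`), so `G = diag((X−τ)^{[i ∈ S]}) · Q` and `det G = (X−τ)^{card S} · det Q`; the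
evaluated quotient `Q(τ)` has rows `b i ⬝ᵥ D b j` (`i ∈ S`, derivative of the factored rows) and
`b i ⬝ᵥ A b j` (`i ∉ S`), is block upper triangular with respect to `(S, Sᶜ)`, and both diagonal
blocks are nonsingular (`D` positive on `ker A`; `A` nondegenerate on the complement).  Hence
`det Q (τ) ≠ 0`, `rootMultiplicity τ (det G) = card S`, and `det G = (det U)² det M` has the same
multiplicity at `τ` as `det M`.  Elementary linear algebra over `ℝ[X]`; Mathlib plus the tree lemma
`LacunarySymmetroidMatrixDescartes.StubInertiaChain.dotProduct_mulVec_comm`.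
-/

-- single-conjunct layout: Sub = Summit, duplicated namespace component intended
set_option linter.dupNamespace false

namespace Summit.ValiantsHypothesis.ValiantsHypothesis.Theorems.SymmetroidDescartes

namespace DerivedPencilRolleQuasiPsdSectorMult

open Polynomial Matrix Finset
open scoped BigOperators

variable {ι : Type*} [Fintype ι] [DecidableEq ι]

omit [DecidableEq ι] in
/-- Entries of a congruence `Uᵀ A U`: the `(i, j)` entry is the pairing of the `i`-th and `j`-th
columns of `U` through `A`. -/
theorem transpose_mul_mul_apply (U A : Matrix ι ι ℝ) (i j : ι) :
    (Uᵀ * A * U) i j = (fun k => U k i) ⬝ᵥ (A *ᵥ fun k => U k j) := by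
  simp only [Matrix.mul_apply, Matrix.transpose_apply, dotProduct, Matrix.mulVec, Finset.mul_sum,
    Finset.sum_mul]
  rw [Finset.sum_comm]
  exact Finset.sum_congr rfl fun k _ => Finset.sum_congr rfl fun l _ => by ring

omit [DecidableEq ι] in
/-- Evaluation commutes with congruence by a constant matrix. -/
theorem map_eval_conj (U : Matrix ι ι ℝ) (M : Matrix ι ι ℝ[X]) (s : ℝ) :
    ((U.map C)ᵀ * M * U.map C).map (eval s) = Uᵀ * M.map (eval s) * U := by
  refine Matrix.ext fun i j => ?_
  simp only [Matrix.map_apply, Matrix.mul_apply, Matrix.transpose_apply, eval_finsetSum, eval_mul,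
    eval_C]

omit [DecidableEq ι] in
/-- Differentiation commutes with congruence by a constant matrix. -/
theorem map_derivative_conj (U : Matrix ι ι ℝ) (M : Matrix ι ι ℝ[X]) :
    ((U.map C)ᵀ * M * U.map C).map (⇑derivative) = (U.map C)ᵀ * M.map (⇑derivative) * U.map C := by
  refine Matrix.ext fun i j => ?_
  simp only [Matrix.map_apply, Matrix.mul_apply, Matrix.transpose_apply, derivative_sum,
    derivative_mul, derivative_C, zero_mul, zero_add, mul_zero, add_zero]

omit [DecidableEq ι] in
/-- A vector pairing to zero with every vector of a basis of `ι → ℝ` is zero. -/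
theorem eq_zero_of_forall_basis_dotProduct (b : Module.Basis ι ℝ (ι → ℝ)) {y : ι → ℝ}
    (h : ∀ i, b i ⬝ᵥ y = 0) : y = 0 := by
  have hy : y ⬝ᵥ y = 0 := by
    calc y ⬝ᵥ y = (∑ i, b.repr y i • b i) ⬝ᵥ y := by rw [b.sum_repr]
      _ = ∑ i, b.repr y i * (b i ⬝ᵥ y) := by
          rw [sum_dotProduct]
          exact Finset.sum_congr rfl fun i _ => by rw [smul_dotProduct, smul_eq_mul]
      _ = 0 := Finset.sum_eq_zero fun i _ => by rw [h i, mul_zero]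
  exact dotProduct_self_eq_zero.1 hy

omit [DecidableEq ι] in
/-- The matrix whose columns are the vectors of a basis `b`, applied to a coefficient vector `c`,
gives the combination `∑ j, c j • b j`. -/
theorem of_basis_mulVec (b : Module.Basis ι ℝ (ι → ℝ)) (c : ι → ℝ) :
    (Matrix.of fun i j => b j i) *ᵥ c = ∑ j, c j • b j := by
  ext k
  simp only [Matrix.mulVec, dotProduct, Matrix.of_apply, Finset.sum_apply, Pi.smul_apply,
    smul_eq_mul]
  exact Finset.sum_congr rfl fun j _ => mul_comm _ _

/-- **Kernel frame.**  Every real square matrix `A` admits a basis `b` of `ι → ℝ` indexed by `ι`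
and a finset `S ⊆ ι` such that `b j ∈ ker A` for `j ∈ S`, while a combination of the `b j`,
`j ∉ S`, lies in `ker A` only if it is trivial (bases of `ker A` and of a complement, re-indexed). -/
theorem exists_kernelFrame (A : Matrix ι ι ℝ) :
    ∃ (b : Module.Basis ι ℝ (ι → ℝ)) (S : Finset ι), (∀ j ∈ S, A *ᵥ (b j) = 0) ∧
      ∀ c : ι → ℝ, (∀ j ∈ S, c j = 0) → A *ᵥ (∑ j, c j • b j) = 0 → c = 0 := by
  classical
  set N : Submodule ℝ (ι → ℝ) := LinearMap.ker (Matrix.mulVecLin A) with hN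
  have hmemN : ∀ x : ι → ℝ, x ∈ N ↔ A *ᵥ x = 0 := fun x => by
    rw [hN, LinearMap.mem_ker, Matrix.mulVecLin_apply]
  obtain ⟨W, hNW⟩ := N.exists_isCompl
  obtain ⟨b₀, hb₀l, hb₀r⟩ : ∃ b₀ : Module.Basis (Fin (Module.finrank ℝ N) ⊕ Fin (Module.finrank ℝ W))
      ℝ (ι → ℝ), (∀ i, b₀ (Sum.inl i) = ((Module.finBasis ℝ N) i : ι → ℝ)) ∧
        (∀ i, b₀ (Sum.inr i) = ((Module.finBasis ℝ W) i : ι → ℝ)) :=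
    ⟨((Module.finBasis ℝ N).prod (Module.finBasis ℝ W)).map (Submodule.prodEquivOfIsCompl N W hNW),
      fun i => by simp [Module.Basis.prod_apply], fun i => by simp [Module.Basis.prod_apply]⟩
  have hcard : Fintype.card (Fin (Module.finrank ℝ N) ⊕ Fin (Module.finrank ℝ W))
      = Fintype.card ι := by
    rw [← Module.finrank_eq_card_basis b₀, Module.finrank_fintype_fun_eq_card]
  obtain ⟨e⟩ : Nonempty ((Fin (Module.finrank ℝ N) ⊕ Fin (Module.finrank ℝ W)) ≃ ι) :=
    ⟨Fintype.equivOfCardEq hcard⟩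
  obtain ⟨b, hb⟩ : ∃ b : Module.Basis ι ℝ (ι → ℝ), ∀ x, b (e x) = b₀ x :=
    ⟨b₀.reindex e, fun x => by rw [Module.Basis.reindex_apply, Equiv.symm_apply_apply]⟩
  refine ⟨b, Finset.univ.image (fun i => e (Sum.inl i)), ?_, ?_⟩
  · intro j hj
    obtain ⟨i, -, rfl⟩ := Finset.mem_image.1 hj
    rw [hb, hb₀l]
    exact (hmemN _).1 ((Module.finBasis ℝ N) i).2
  · intro c hc hker
    have hW : (∑ j, c j • b j) ∈ W := by
      refine Submodule.sum_mem W fun j _ => ?_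
      obtain ⟨x, rfl⟩ := e.surjective j
      cases x with
      | inl i =>
          rw [hc _ (Finset.mem_image.2 ⟨i, Finset.mem_univ _, rfl⟩), zero_smul]
          exact W.zero_mem
      | inr i =>
          rw [hb, hb₀r]
          exact W.smul_mem _ ((Module.finBasis ℝ W) i).2
    have hNmem : (∑ j, c j • b j) ∈ N := (hmemN _).2 hker
    have h0 : (∑ j, c j • b j) = 0 := Submodule.disjoint_def.1 hNW.disjoint _ hNmem hW
    exact funext ((Fintype.linearIndependent_iff.1 b.linearIndependent) c h0)

/-- **Multiplicity = nullity.**  Let `M` be a real polynomial matrix, `τ ∈ ℝ`, `A = M(τ)` symmetric,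
and `(b, S)` a kernel frame of `A` (`b j ∈ ker A` for `j ∈ S`; combinations of the other `b j`
meet `ker A` trivially).  If the quadratic form of `D = M′(τ)` is positive at every nonzero
combination of the `b j`, `j ∈ S`, then the multiplicity of `τ` as a root of `det M` is exactly
`card S`. -/
theorem rootMultiplicity_det_eq_card (M : Matrix ι ι ℝ[X]) (τ : ℝ) (b : Module.Basis ι ℝ (ι → ℝ))
    (S : Finset ι) (hsymm : (M.map (eval τ)).IsSymm)
    (hker : ∀ j ∈ S, M.map (eval τ) *ᵥ (b j) = 0)
    (hcompl : ∀ c : ι → ℝ, (∀ j ∈ S, c j = 0) → M.map (eval τ) *ᵥ (∑ j, c j • b j) = 0 → c = 0)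
    (hder : ∀ c : ι → ℝ, (∀ j, j ∉ S → c j = 0) → c ≠ 0 →
      0 < (∑ j, c j • b j) ⬝ᵥ (M.map (fun q => (derivative q).eval τ) *ᵥ ∑ j, c j • b j)) :
    (M.det).rootMultiplicity τ = S.card := by
  classical
  set A := M.map (eval τ) with hA
  set D := M.map (fun q => (derivative q).eval τ) with hD
  -- change of basis: the columns of `U` are the basis vectors
  set U : Matrix ι ι ℝ := Matrix.of fun i j => b j i with hU
  set G : Matrix ι ι ℝ[X] := (U.map C)ᵀ * M * U.map C with hG
  -- entries of `G`, evaluated and differentiated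
  have hGeval : ∀ (s : ℝ) (i j : ι), (G i j).eval s = b i ⬝ᵥ (M.map (eval s) *ᵥ b j) := by
    intro s i j
    have h := congrFun (congrFun (map_eval_conj U M s) i) j
    rw [Matrix.map_apply] at h
    rw [hG, h, transpose_mul_mul_apply]
    rfl
  have hGder : ∀ i j : ι, (derivative (G i j)).eval τ = b i ⬝ᵥ (D *ᵥ b j) := by
    intro i j
    have h1 := congrFun (congrFun (map_derivative_conj U M) i) j
    rw [Matrix.map_apply] at h1
    have h2 := congrFun (congrFun (map_eval_conj U (M.map (⇑derivative)) τ) i) j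
    rw [Matrix.map_apply, Matrix.map_map] at h2
    rw [hG, h1, h2, transpose_mul_mul_apply]
    rfl
  -- the rows indexed by `S` vanish at `τ`
  have hrow : ∀ i ∈ S, ∀ j, (G i j).IsRoot τ := by
    intro i hi j
    rw [IsRoot.def, hGeval, LacunarySymmetroidMatrixDescartes.StubInertiaChain.dotProduct_mulVec_comm hsymm, hker i hi, dotProduct_zero]
  -- factor `X - C τ` out of those rows
  set Q : Matrix ι ι ℝ[X] :=
    Matrix.of fun i j => if i ∈ S then G i j /ₘ (X - C τ) else G i j with hQ
  have hGQ : G = Matrix.diagonal (fun i => if i ∈ S then X - C τ else 1) * Q := by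
    refine Matrix.ext fun i j => ?_
    rw [Matrix.diagonal_mul, hQ, Matrix.of_apply]
    split_ifs with hi
    · exact (mul_divByMonic_eq_iff_isRoot.2 (hrow i hi j)).symm
    · exact (one_mul _).symm
  have hdetG : G.det = (X - C τ) ^ S.card * Q.det := by
    rw [hGQ, Matrix.det_mul, Matrix.det_diagonal, Finset.prod_ite, Finset.prod_const_one, mul_one,
      Finset.prod_const, Finset.filter_mem_eq_inter, Finset.univ_inter]
  -- the evaluated quotient matrix
  set Qτ : Matrix ι ι ℝ := Q.map (eval τ) with hQτ
  have hQτS : ∀ i ∈ S, ∀ j, Qτ i j = b i ⬝ᵥ (D *ᵥ b j) := by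
    intro i hi j
    rw [hQτ, Matrix.map_apply, hQ, Matrix.of_apply, if_pos hi]
    have hfac := mul_divByMonic_eq_iff_isRoot.2 (hrow i hi j)
    have hd : derivative (G i j)
        = G i j /ₘ (X - C τ) + (X - C τ) * derivative (G i j /ₘ (X - C τ)) := by
      conv_lhs => rw [← hfac]
      rw [derivative_mul, derivative_X_sub_C, one_mul]
    rw [← hGder, hd, eval_add, eval_mul, eval_sub, eval_X, eval_C, sub_self, zero_mul, add_zero]
  have hQτnS : ∀ i, i ∉ S → ∀ j, Qτ i j = b i ⬝ᵥ (A *ᵥ b j) := by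
    intro i hi j
    rw [hQτ, Matrix.map_apply, hQ, Matrix.of_apply, if_neg hi]
    exact hGeval τ i j
  have hzero : ∀ i, ¬ i ∈ S → ∀ j, j ∈ S → Qτ i j = 0 := by
    intro i hi j hj
    rw [hQτnS i hi j, hker j hj, dotProduct_zero]
  have hdetQτ := Matrix.twoBlockTriangular_det Qτ (· ∈ S) hzero
  -- the `S × S` block `[b i ⬝ᵥ D b j]` is nonsingular: `D` is positive on `span {b j : j ∈ S}`
  have hSS : (Qτ.toSquareBlockProp (· ∈ S)).det ≠ 0 := by
    intro hdet0
    obtain ⟨w, hw, hw0⟩ := Matrix.exists_mulVec_eq_zero_iff.2 hdet0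
    let c : ι → ℝ := fun j => if hj : j ∈ S then w ⟨j, hj⟩ else 0
    have hcS : ∀ j, j ∉ S → c j = 0 := fun j hj => by simp [c, hj]
    have hc0 : c ≠ 0 := by
      intro hc
      apply hw
      ext j
      have h := congrFun hc j
      simpa [c, j.2] using h
    have hpos := hder c hcS hc0
    set x := ∑ j, c j • b j with hx
    have hx' : x = ∑ j : {a // a ∈ S}, w j • b j := by
      have h1 : ∑ j : {a // a ∈ S}, w j • b j = ∑ j ∈ S, c j • b j := by
        rw [← Finset.sum_coe_sort S (fun j => c j • b j)]
        exact Finset.sum_congr rfl fun j _ => by simp [c, j.2]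
      rw [h1, hx]
      exact (Finset.sum_subset (Finset.subset_univ S) fun j _ hj => by rw [hcS j hj, zero_smul]).symm
    have hDx : ∀ i : {a // a ∈ S}, b i ⬝ᵥ (D *ᵥ x) = 0 := by
      intro i
      have h := congrFun hw0 i
      rw [Pi.zero_apply, Matrix.mulVec, dotProduct] at h
      simp only [Matrix.toSquareBlockProp_def, Matrix.of_apply] at h
      rw [hx', Matrix.mulVec_sum, dotProduct_sum]
      rw [← h]
      exact Finset.sum_congr rfl fun j _ => by
        rw [hQτS _ i.2, Matrix.mulVec_smul, dotProduct_smul, smul_eq_mul, mul_comm]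
    have hxDx : x ⬝ᵥ (D *ᵥ x) = 0 := by
      rw [congrArg (fun z => z ⬝ᵥ (D *ᵥ x)) hx', sum_dotProduct]
      exact Finset.sum_eq_zero fun i _ => by rw [smul_dotProduct, hDx i, smul_zero]
    rw [hxDx] at hpos
    exact lt_irrefl 0 hpos
  -- the `Sᶜ × Sᶜ` block `[b i ⬝ᵥ A b j]` is nonsingular: `A` is nondegenerate off the kernel
  have hNN : (Qτ.toSquareBlockProp (fun i => ¬ i ∈ S)).det ≠ 0 := by
    intro hdet0
    obtain ⟨w, hw, hw0⟩ := Matrix.exists_mulVec_eq_zero_iff.2 hdet0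
    let c : ι → ℝ := fun j => if hj : j ∈ S then 0 else w ⟨j, hj⟩
    have hcS : ∀ j ∈ S, c j = 0 := fun j hj => by simp [c, hj]
    set x := ∑ j, c j • b j with hx
    have hx' : x = ∑ j : {a // ¬ a ∈ S}, w j • b j := by
      have h1 : ∑ j : {a // ¬ a ∈ S}, w j • b j = ∑ j ∈ Finset.univ.filter (fun a => ¬ a ∈ S),
          c j • b j := by
        rw [← Finset.sum_coe_sort (Finset.univ.filter (fun a => ¬ a ∈ S)) (fun j => c j • b j)]
        refine Fintype.sum_equiv ((Equiv.refl ι).subtypeEquiv fun a => by simp) _ _ fun j => ?_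
        have hj : (j : ι) ∉ S := j.2
        simp [c, hj]
      rw [h1, hx]
      exact (Finset.sum_subset (Finset.filter_subset _ _) fun j _ hj => by
        have hjS : j ∈ S := by simpa using hj
        rw [hcS j hjS, zero_smul]).symm
    have h1 : ∀ i : {a // ¬ a ∈ S}, b i ⬝ᵥ (A *ᵥ x) = 0 := by
      intro i
      have h := congrFun hw0 i
      rw [Pi.zero_apply, Matrix.mulVec, dotProduct] at h
      simp only [Matrix.toSquareBlockProp_def, Matrix.of_apply] at h
      rw [hx', Matrix.mulVec_sum, dotProduct_sum, ← h]
      exact Finset.sum_congr rfl fun j _ => by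
        rw [hQτnS _ i.2, Matrix.mulVec_smul, dotProduct_smul, smul_eq_mul, mul_comm]
    have h2 : ∀ i ∈ S, b i ⬝ᵥ (A *ᵥ x) = 0 := fun i hi => by
      rw [LacunarySymmetroidMatrixDescartes.StubInertiaChain.dotProduct_mulVec_comm hsymm, hker i hi, dotProduct_zero]
    have hall : ∀ i, b i ⬝ᵥ (A *ᵥ x) = 0 := fun i =>
      if hi : i ∈ S then h2 i hi else h1 ⟨i, hi⟩
    have hAx : A *ᵥ x = 0 := eq_zero_of_forall_basis_dotProduct b hall
    have hc0 : c = 0 := hcompl c hcS (by rw [← hx]; exact hAx)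
    apply hw
    ext j
    have h := congrFun hc0 j
    have hj : (j : ι) ∉ S := j.2
    simpa [c, hj] using h
  -- hence `det Q` does not vanish at `τ`
  have hQτdet : Qτ.det ≠ 0 := by
    rw [hdetQτ]
    convert mul_ne_zero hSS hNN
  have hevaldet : (Q.det).eval τ = Qτ.det := by
    have h' := RingHom.map_det (evalRingHom τ) Q
    rw [RingHom.mapMatrix_apply, coe_evalRingHom] at h'
    rw [h', hQτ]
  have hQdet_eval : ¬ (Q.det).IsRoot τ := fun h => hQτdet (by rwa [IsRoot.def, hevaldet] at h)
  have hQne : Q.det ≠ 0 := fun h => hQdet_eval (by rw [h, IsRoot.def, eval_zero])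
  have hprod : (X - C τ) ^ S.card * Q.det ≠ 0 :=
    mul_ne_zero (pow_ne_zero _ (X_sub_C_ne_zero τ)) hQne
  have hGne : G.det ≠ 0 := by
    rw [hdetG]
    exact hprod
  have hmultG : (G.det).rootMultiplicity τ = S.card := by
    rw [hdetG, rootMultiplicity_mul hprod, rootMultiplicity_X_sub_C_pow,
      rootMultiplicity_eq_zero hQdet_eval, add_zero]
  -- `det G = C (det U) * det M * C (det U)` has the same multiplicity at `τ` as `det M`
  have hCU : (U.map C).det = C U.det := by
    rw [← RingHom.mapMatrix_apply, ← RingHom.map_det]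
  have hdetG' : G.det = C U.det * M.det * C U.det := by
    rw [hG, Matrix.det_mul, Matrix.det_mul, Matrix.det_transpose, hCU]
  have hne : C U.det * M.det * C U.det ≠ 0 := by
    rw [← hdetG']
    exact hGne
  have hne1 : C U.det * M.det ≠ 0 := left_ne_zero_of_mul hne
  rw [← hmultG, hdetG', rootMultiplicity_mul hne, rootMultiplicity_mul hne1, rootMultiplicity_C,
    zero_add, add_zero]
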